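import Mathlib
import Summits.Schanuel.Schanuel.Theses.RigidCore
import Summits.Schanuel.Schanuel.Theorems.RigidCoreMinimalCounterexampleInAclCorankOne
import Summits.Schanuel.Schanuel.Theorems.RigidCoreMinimalCounterexampleInAclCorankGeTwoLogPart
import Summits.Schanuel.Schanuel.Theorems.RigidCoreMinimalCounterexampleInAclCorankGeTwoHitSetRingDefinable
import Literature.ModelTheory.ExponentialFields.RealAnExpCounting

/-!
# Sketch — crux idea `ominimal-height-split` (lens: transfer of the Pila–Zannier counting strategy)
# for the L-child `LogCoordsCorankGeTwoInAcl` of crux stmt-Schanuel-0969 (S*)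

Strategist planner-cstrat-stmt-Schanuel-0969-p1-0, 2026-08-17.  Typed design of the line recommended in
`Cruxes/MinimalCounterexampleInAcl/STRATEGY-CENSUS.md` §Transfer T6 / §5.2 — NOT registered on stmt-0969 (its closing would still need
R₃ and S7′); its home is the child item L once the split (glue p165527) is applied.

* `stub_realAnExp_isOMinimal` — the named Literature fact (van den Dries–Miller 1994): `ℝ_an,exp` is o-minimal.
* `stub_polyHeightHitsSparse` (PH′) — POWER SPARSITY OF POLYNOMIAL-HEIGHT HITS: for a normal-form corank ≥ 2 first failure `x`, a log
  direction `μ ≠ 0`, an exponent `A` and `ε > 0`, the number of branches `j ∈ [−N, N]` over which some mate of `x` with log part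
  `x + 2πijμ` has pure coordinates of norm `≤ N^A` is `≤ c N^ε`.  Engine: Pila–Wilkie (`PilaWilkie2006_thm_1_8_holds`, PROVED) on the
  set of real-parametrised hits (definable in `Language.realAnExp`), Ax–Schanuel (`ax_schanuel_holds`) along the algebraic part through the
  Hardy field of definable germs, common-rational-vector lemma on analytic cells, descent through dead directions (landed c13/c16 machinery).
* `stub_tallHitBranchesNotFull` (TALL*) — the research residual: for some `A` the branches in `[−N, N]` carrying a mate with a pure coordinate of
  norm `> N^A` number at most `δ(2N+1)`, `δ < 1`, for large `N`.
* glue `noFullLine_of_heightSplit` (PROVED here): PH′ ∧ TALL* ⇒ S7b (some branch along every log line carries no mate), hence with the landed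
  S7a (`stub_corankGeTwo_hitSetRingDefinable`) and `logCoords_mem_expAcl_of_ringDefinable_of_noFullLine` the statement L (`logCoords_of_stubs`).
-/

noncomputable section

open Complex Set FirstOrder

namespace Summit.Schanuel.Schanuel.Cruxes.MinimalCounterexampleInAcl.OminimalHeightSplit

open Literature.NumberTheory.Transcendental (SchanuelRank)
open Literature.ModelTheory.ExponentialFields
open Summit.Schanuel.Schanuel.Theorems.AclSubsetLogFreeCore.Negative (expAcl)
open Summit.Schanuel.Schanuel.Cruxes.MinimalCounterexampleInAcl.KernelArithmeticSelection (firstFailures locusMates)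

variable {n : ℕ}

/-- The branches `j ∈ [−N, N]` over which `x` has a mate with log part shifted by `jμ` and pure part of sup-norm `≤ B`. -/
def shortHitBranches (r : ℕ) (x : Fin n → ℂ) (μ : Fin n → ℤ) (N : ℕ) (B : ℝ) : Set ℤ :=
  {j : ℤ | |j| ≤ N ∧ ∃ x' ∈ locusMates x,
      (∀ i : Fin n, (i : ℕ) < r → x' i = x i + 2 * ↑Real.pi * I * ((j • μ) i : ℂ)) ∧
      (∀ i : Fin n, r ≤ (i : ℕ) → ‖x' i‖ ≤ B)}

/-- The branches `j ∈ [−N, N]` over which `x` has a mate with log part shifted by `jμ` and SOME pure coordinate of norm `> B`. -/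
def tallHitBranches (r : ℕ) (x : Fin n → ℂ) (μ : Fin n → ℤ) (N : ℕ) (B : ℝ) : Set ℤ :=
  {j : ℤ | |j| ≤ N ∧ ∃ x' ∈ locusMates x,
      (∀ i : Fin n, (i : ℕ) < r → x' i = x i + 2 * ↑Real.pi * I * ((j • μ) i : ℂ)) ∧
      (∃ i : Fin n, r ≤ (i : ℕ) ∧ B < ‖x' i‖)}

/-- Stub O — the named Literature fact: `ℝ_an,exp` is o-minimal (van den Dries–Miller 1994; reduction to model completeness +
Khovanskii finiteness in `RealAnExpOMinimalProofs`). -/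
theorem stub_realAnExp_isOMinimal : VandendriesMiller1994_realAnExp_isOMinimal := by
  sorry

/-- Stub PH′ — POWER SPARSITY OF POLYNOMIAL-HEIGHT HITS along a kernel line in a log direction (Pila–Zannier for first failures). -/
theorem stub_polyHeightHitsSparse : VandendriesMiller1994_realAnExp_isOMinimal →
    ∀ (n r : ℕ), 3 ≤ n → r + 2 ≤ n → ∀ x : Fin n → ℂ, x ∈ firstFailures n →
      (∀ i : Fin n, (i : ℕ) < r → IsAlgebraic ℚ (cexp (x i))) →
      (∀ M : Fin n → ℤ, (∃ i : Fin n, r ≤ (i : ℕ) ∧ M i ≠ 0) → Transcendental ℚ (cexp (∑ i, (M i : ℂ) * x i))) →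
      ∀ μ : Fin n → ℤ, (∀ i : Fin n, r ≤ (i : ℕ) → μ i = 0) → μ ≠ 0 →
      ∀ (A : ℕ) (ε : ℝ), 0 < ε → ∃ c : ℝ, ∀ N : ℕ, 1 ≤ N →
        (shortHitBranches r x μ N ((N : ℝ) ^ A)).Finite ∧
        ((shortHitBranches r x μ N ((N : ℝ) ^ A)).ncard : ℝ) ≤ c * (N : ℝ) ^ ε := by
  sorry

/-- Stub TALL* — the research residual: tall hits do not fill the line. -/
theorem stub_tallHitBranchesNotFull :
    ∀ (n r : ℕ), 3 ≤ n → r + 2 ≤ n → ∀ x : Fin n → ℂ, x ∈ firstFailures n →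
      (∀ i : Fin n, (i : ℕ) < r → IsAlgebraic ℚ (cexp (x i))) →
      (∀ M : Fin n → ℤ, (∃ i : Fin n, r ≤ (i : ℕ) ∧ M i ≠ 0) → Transcendental ℚ (cexp (∑ i, (M i : ℂ) * x i))) →
      ∀ μ : Fin n → ℤ, (∀ i : Fin n, r ≤ (i : ℕ) → μ i = 0) → μ ≠ 0 →
      ∃ (A : ℕ) (δ : ℝ), δ < 1 ∧ ∃ N₀ : ℕ, ∀ N : ℕ, N₀ ≤ N →
        (tallHitBranches r x μ N ((N : ℝ) ^ A)).Finite ∧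
        ((tallHitBranches r x μ N ((N : ℝ) ^ A)).ncard : ℝ) ≤ δ * (2 * (N : ℝ) + 1) := by
  sorry

/-- Every hit branch in `[−N, N]` is short or tall at level `B`. -/
theorem hitBranch_mem_union {r : ℕ} {x : Fin n → ℂ} {μ : Fin n → ℤ} {N : ℕ} {B : ℝ} {j : ℤ} (hj : |j| ≤ N)
    (hhit : ∃ x' ∈ locusMates x, ∀ i : Fin n, (i : ℕ) < r → x' i = x i + 2 * ↑Real.pi * I * ((j • μ) i : ℂ)) :
    j ∈ shortHitBranches r x μ N B ∪ tallHitBranches r x μ N B := by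
  obtain ⟨x', hx', hlog⟩ := hhit
  by_cases h : ∀ i : Fin n, r ≤ (i : ℕ) → ‖x' i‖ ≤ B
  · exact Or.inl ⟨hj, x', hx', hlog, h⟩
  · push Not at h
    obtain ⟨i, hi, hB⟩ := h
    exact Or.inr ⟨hj, x', hx', hlog, i, hi, hB⟩

/-- **GLUE (sorry-free): PH′ ∧ TALL* ⇒ S7b** — along every non-zero log direction some branch carries no mate. -/
theorem noFullLine_of_heightSplit {r : ℕ} {x : Fin n → ℂ} {μ : Fin n → ℤ}
    (hP : ∀ (A : ℕ) (ε : ℝ), 0 < ε → ∃ c : ℝ, ∀ N : ℕ, 1 ≤ N →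
        (shortHitBranches r x μ N ((N : ℝ) ^ A)).Finite ∧
        ((shortHitBranches r x μ N ((N : ℝ) ^ A)).ncard : ℝ) ≤ c * (N : ℝ) ^ ε)
    (hT : ∃ (A : ℕ) (δ : ℝ), δ < 1 ∧ ∃ N₀ : ℕ, ∀ N : ℕ, N₀ ≤ N →
        (tallHitBranches r x μ N ((N : ℝ) ^ A)).Finite ∧
        ((tallHitBranches r x μ N ((N : ℝ) ^ A)).ncard : ℝ) ≤ δ * (2 * (N : ℝ) + 1)) :
    ∃ j : ℤ, ¬ ∃ x' ∈ locusMates x, ∀ i : Fin n, (i : ℕ) < r → x' i = x i + 2 * ↑Real.pi * I * ((j • μ) i : ℂ) := by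
  obtain ⟨A, δ, hδ, N₀, hTN⟩ := hT
  obtain ⟨c, hc⟩ := hP A (1 / 2) (by norm_num)
  by_contra hall
  push Not at hall
  -- for every N ≥ max N₀ 1: 2N+1 ≤ #short + #tall ≤ c √N + δ (2N+1)
  have key : ∀ N : ℕ, N₀ ≤ N → 1 ≤ N → (2 * (N : ℝ) + 1) ≤ c * (N : ℝ) ^ (1 / 2 : ℝ) + δ * (2 * (N : ℝ) + 1) := by
    intro N hN0 hN1
    obtain ⟨hSf, hSc⟩ := hc N hN1
    obtain ⟨hTf, hTc⟩ := hTN N hN0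
    set S := shortHitBranches r x μ N ((N : ℝ) ^ A) with hS
    set T := tallHitBranches r x μ N ((N : ℝ) ^ A) with hT'
    have hsub : (Finset.Icc (-(N : ℤ)) N : Set ℤ) ⊆ S ∪ T := by
      intro j hj
      have hj' : |j| ≤ N := by
        rw [Finset.coe_Icc] at hj
        exact abs_le.2 hj
      obtain ⟨x', hx', hlog⟩ := hall j
      exact hitBranch_mem_union hj' ⟨x', hx', hlog⟩
    have hcard : ((Finset.Icc (-(N : ℤ)) N : Set ℤ)).ncard ≤ S.ncard + T.ncard :=
      (Set.ncard_le_ncard hsub (hSf.union hTf)).trans (Set.ncard_union_le S T)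
    have hIcc : ((Finset.Icc (-(N : ℤ)) N : Set ℤ)).ncard = 2 * N + 1 := by
      rw [Set.ncard_coe_finset, Int.card_Icc]
      omega
    have h1 : (2 * (N : ℝ) + 1) ≤ (S.ncard : ℝ) + (T.ncard : ℝ) := by
      have := hcard
      rw [hIcc] at this
      exact_mod_cast this
    have hpow : (N : ℝ) ^ (1 / 2 : ℝ) = (N : ℝ) ^ ((1 : ℝ) / 2) := rfl
    linarith [hSc, hTc]
  -- contradiction for large N: (1 - δ)(2N+1) ≤ c √N
  have hδ' : 0 < 1 - δ := by linarith
  set k : ℝ := (|c| + 1) / (1 - δ) with hk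
  have hk0 : 0 ≤ k := div_nonneg (by positivity) hδ'.le
  obtain ⟨N, hN⟩ := exists_nat_ge (max ((max N₀ 1 : ℕ) : ℝ) (k ^ 2))
  have hNN : ((max N₀ 1 : ℕ) : ℝ) ≤ N := (le_max_left _ _).trans hN
  have hN0 : N₀ ≤ N := by exact_mod_cast (le_max_left N₀ 1).trans (show (max N₀ 1 : ℕ) ≤ N by exact_mod_cast hNN)
  have hN1 : 1 ≤ N := by exact_mod_cast (le_max_right N₀ 1).trans (show (max N₀ 1 : ℕ) ≤ N by exact_mod_cast hNN)
  have hN1r : (1 : ℝ) ≤ N := by exact_mod_cast hN1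
  have hk2 : k ^ 2 ≤ N := (le_max_right _ _).trans hN
  have hsq : (N : ℝ) ^ (1 / 2 : ℝ) = Real.sqrt N := by rw [Real.sqrt_eq_rpow]
  have hkle : k ≤ Real.sqrt N := by
    calc k = Real.sqrt (k ^ 2) := (Real.sqrt_sq hk0).symm
      _ ≤ Real.sqrt N := Real.sqrt_le_sqrt hk2
  have hsqrt0 : 0 ≤ Real.sqrt N := Real.sqrt_nonneg _
  have hsqN : Real.sqrt N * Real.sqrt N = N := Real.mul_self_sqrt (by positivity)
  have hmain := key N hN0 hN1
  rw [hsq] at hmain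
  -- c √N ≤ |c| √N < (|c|+1) √N ≤ (1-δ) √N √N = (1-δ) N ≤ (1-δ)(2N+1)
  have h1 : c * Real.sqrt N ≤ |c| * Real.sqrt N := mul_le_mul_of_nonneg_right (le_abs_self c) hsqrt0
  have h2 : (|c| + 1) ≤ (1 - δ) * Real.sqrt N := by
    have := mul_le_mul_of_nonneg_left hkle hδ'.le
    rw [hk, mul_div_cancel₀ _ hδ'.ne'] at this
    exact this
  have h3 : (|c| + 1) * Real.sqrt N ≤ (1 - δ) * (N : ℝ) := by
    have := mul_le_mul_of_nonneg_right h2 hsqrt0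
    rw [mul_assoc, hsqN] at this
    exact this
  nlinarith [hsqrt0, abs_nonneg c, hN1r]

/-- **Composition to L (sorry only in the stubs):** the log coordinates of every normal-form corank ≥ 2 first failure are in `acl(∅)`. -/
theorem logCoords_of_stubs : ∀ (n r : ℕ), 3 ≤ n → r + 2 ≤ n → ∀ x : Fin n → ℂ, x ∈ firstFailures n →
    (∀ i : Fin n, (i : ℕ) < r → IsAlgebraic ℚ (cexp (x i))) →
    (∀ M : Fin n → ℤ, (∃ i : Fin n, r ≤ (i : ℕ) ∧ M i ≠ 0) → Transcendental ℚ (cexp (∑ i, (M i : ℂ) * x i))) →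
    ∀ i : Fin n, (i : ℕ) < r → x i ∈ expAcl := by
  intro n r hn hr x hx halg hpure
  refine KernelArithmeticSelection.logCoords_mem_expAcl_of_ringDefinable_of_noFullLine (by omega) hx.1 halg
    (@KernelArithmeticSelection.stub_corankGeTwo_hitSetRingDefinable n r hn hr x hx halg hpure
      (FirstOrder.Ring.compatibleRingOfRing ℤ)) ?_
  intro μ hμ hμ0
  exact noFullLine_of_heightSplit
    (stub_polyHeightHitsSparse stub_realAnExp_isOMinimal n r hn hr x hx halg hpure μ hμ hμ0)
    (stub_tallHitBranchesNotFull n r hn hr x hx halg hpure μ hμ hμ0)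

end Summit.Schanuel.Schanuel.Cruxes.MinimalCounterexampleInAcl.OminimalHeightSplit

end
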